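import Summits.BirchSwinnertonDyer.BirchSwinnertonDyer.Theorems.ManinLocalTwoThreeShimuraClasses
import HarnessLib


/-!
# C2 `ManinOddAtFour` helper (es g45, T-es-102, part 2 of 2: §3–§5, the levels `17, 20, 24, 32`; §1–§2 = `…ShimuraClasses`) — SHIMURA COVERING CLASSES `φ_χ : H₁(X₀(N), ℤ) → R` AT ARBITRARY LEVEL,
# FACT-FREE; the `2`-PRIMARY classes at the ADDITIVE genus-one levels `20`, `24`, `32` and at `17`: the Shimura index
# `[Λ(f) : Λ₁(f)]` is EVEN for every `f ≠ 0` in `S₂(Γ₀(N))`, `N ∈ {20, 24, 32}`, and the class of `{∞, γ₃∞}_f` is not killed by `2`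
# in `Λ(f)/Λ₁(f)` on `S₂(Γ₀(17))`

HONEST FRAMING. Printed mathematics (Mazur 1977 §II.11; Ling–Oesterlé 1991 Thm 1: the Shimura subgroup `Σ(N) = ker(J₀(N) → J₁(N))`
and its order; Stevens 1989 §2), new formal proofs. Beyond-print theorem: NO. Nothing about the Manin constant of any curve is
asserted; C2, C3, Manin's conjecture and BSD stay OPEN. No `sorry`, no new axiom, no instance/notation.

WHAT. §1 (`exists_shimuraHom`): `N ≥ 1`, `m ∣ N` with the CUSP CONDITION `N ∣ w·r² ⇒ m ∣ w·r` (automatic for squarefree `m`;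
for `m = ℓ^κ` it says `ℓ^{2κ−1} ∣ N`), `R` an additive group without `3`-torsion, `χ : ℤ/m → R` additive on units and even, and the
ELLIPTIC CONDITION `N ∣ d² + 1 ⇒ χ(d) = 0` (vacuous when `4 ∣ N`). Then the SHIMURA CHARACTER `u_χ(γ) := χ(d_γ mod m)` of `Γ₀(N)` is
additive, kills every cusp stabiliser (`γ = kβk⁻¹`, `β = ±(1 w; 0 1)`, forces `γ₁₀ = −w r²`, `d_γ = ±1 + w p r` with `(p, r)` the first
column of `k` — `apply_one_one_eq_of_conj_upper` — so `N ∣ w r²`, `m ∣ w r`, `d_γ ≡ ±1 (mod m)`) and every order-`4` elliptic element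
(`γ² = −1 ⇒ N ∣ d_γ² + 1`); by the LANDED factorisation `ThetaLayerLambdaCongruenceAtTwo.exists_addMonoidHom_periodHomology_of_cuspCharacter`
(route ResidualThetaTransportAtTwo, p3-w2; genus formula a tree theorem) it FACTORS THROUGH THE PERIOD LATTICE:
`∃ φ : periodHomology N →+ R, φ({∞, k∞}) = χ(d_k mod m)` for all `k ∈ Γ₀(N)`. `exists_shimuraHom_of_four_dvd`: at levels `4 ∣ N` only
the cusp condition remains — for every prime `q` with `4q ∣ N` and every even additive-on-units `χ : ℤ/q → R` (e.g. the Legendre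
symbol for `q ≡ 1 (mod 4)`, read in `ℤ/2`) there is a `2`-primary Shimura class at the ADDITIVE level `N`.
§2 (`zsmul_cuspSymbol_not_mem_of_hom`): on a line `S₂(Γ₀(N)) = ℂ·f` a class descends to `Λ(f)`: `n·{∞, γ∞}_f ∉ Λ₁(f)` whenever
`n·χ(d_γ) ≠ 0` (evaluation at `f` is injective on the dual of a line; `Λ₁(f)` is generated by `Γ₁(N)`-periods, `d ≡ 1`).
§3 LEVEL `17` (`n(17) = 4`; `χ₁₇ = log₃ mod 4 : ℤ/17 → ℤ/4`, a decide-table; `γ₃ = (6 1; 17 3)`; `dim S₂(Γ₀(17)) = g = 1` by the tree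
theorems `finrank_cuspForm_two_eq_genusX0_holds`, `genusX0_prime`): **`n·{∞, γ₃∞}_f ∉ Λ₁(f)` for `4 ∤ n`**, so `Λ(f) ≠ Λ₁(f)` and
`2Λ(f) ⊄ Λ₁(f)` for every `f ≠ 0` (E15-LATTICE-INDEX-v1 row `17a1`: index `4`, snf `[4,1]`).
§4 THE ADDITIVE LEVEL `20 = 4·5` (`χ₅` = Legendre symbol mod `5` read in `ℤ/2`; `γ₇ = (3 1; 20 7)`, `(7|5) = (2|5) = −1`;
`dim S₂(Γ₀(20)) = 1` = `finrank_cuspForm_two_eq_genusX0_twenty`): **`{∞, γ₇∞}_f ∉ Λ₁(f)` and `Λ(f) ≠ Λ₁(f)` for every non-zero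
`f ∈ S₂(Γ₀(20))`** — the Shimura index at the additive level `20` is EVEN, fact-free (E15 row `20a1`: index `2`, snf `[2,1]`). For
C2 this is a NEGATIVE datum: «`[Λ₀ : Λ₁]` odd at `4 ∣ N`» is false already at `N = 20`, so the `2`-part of `c₀` cannot be read off `c₁`
by index parity alone at such levels (the route's Stevens-parity reduction rightly restricts to Kummer-blind classes).
§5 THE ADDITIVE GENUS-ONE LEVELS `24 = 8·3` AND `32 = 2⁵` (prime-power moduli: `χ₁₂ = (12 | ·)` needs `2³ ∣ N`, `χ₈ = (2 | ·)` needs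
`2⁵ ∣ N`; the cusp condition is a finite residue check `cuspCondition_of_residues`, by `decide` mod `24` / `32`; `dim S₂ = 1` by
`genusX0_twentyFour` / `finrank_cuspForm_two_eq_genusX0_thirtyTwo`): **`Λ(f) ≠ Λ₁(f)` for every non-zero `f` in `S₂(Γ₀(24))` and in
`S₂(Γ₀(32))`** (E15 rows `24a1`, `32a1`: index `2`). In the language of `…ManinLocalTwoThreeShimuraTwoCharOfPeriods` (the period class
is a Kronecker symbol `(q | d_γ)` for an admissible squarefree `q ∣ N`, triviality undecided there): `q ≠ 1` at `N = 20, 24, 32` — the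
class IS `(5 | ·)`, `(12 | ·) = (3 | ·)χ₋₄`, `(2 | ·)` respectively, non-trivial. The remaining genus-one level with `4 ∣ N`, `36`, admits
no even cusp-unramified quadratic character (E15 row `36a1`: index `1`); `27` (`9 ∣ N`, C3) carries a CUBIC class (E15 `27a1`: index `3`)
outside the reach of the landed factorisation, whose coefficient group must have no `3`-torsion.

References: [Mazur1977] §II.11; [LingOesterle1991] Thm. 1; [Stevens1989] §2; [Manin1972] §1.5–1.7, Thm. 1.9; [CremonaAlgorithms1997] §2.1–2.2.
-/

set_option autoImplicit false

noncomputable section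

-- justification: the `Summit.BirchSwinnertonDyer.BirchSwinnertonDyer.…` path repeats a component (route-file convention)
set_option linter.dupNamespace false

open scoped Classical MatrixGroups

open CongruenceSubgroup Matrix.SpecialLinearGroup ModularGroup
open Literature.NumberTheory.EllipticCurves.ModularForms
open Summit.BirchSwinnertonDyer.BirchSwinnertonDyer.Theorems.ThetaLayerLambdaCongruenceAtTwo

namespace Summit.BirchSwinnertonDyer.BirchSwinnertonDyer.Theorems.ManinLocalTwoThree.ShimuraClass

/-! ## §3. Level `17`: the `2`-primary Shimura class of order `4` -/

section Seventeen

/-- `χ₁₇ = log₃ mod 4` on `ℤ/17` (`3` a primitive root), `χ₁₇(0) = 0`. [folklore] -/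
def charSeventeen (x : ZMod 17) : ZMod 4 :=
  match x.val with
  | 3 => 1 | 9 => 2 | 10 => 3 | 5 => 1 | 15 => 2 | 11 => 3 | 14 => 1 | 8 => 2 | 7 => 3 | 12 => 1 | 2 => 2 | 6 => 3
  | _ => 0

/-- `χ₁₇` is additive on units. [folklore] -/
theorem charSeventeen_mul : ∀ x x' y y' : ZMod 17, x * x' = 1 → y * y' = 1 →
    charSeventeen (x * y) = charSeventeen x + charSeventeen y := by
  decide

/-- `χ₁₇` is even. [folklore] -/
theorem charSeventeen_neg : ∀ x : ZMod 17, charSeventeen (-x) = charSeventeen x := by decide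

/-- `χ₁₇` kills the square roots of `−1` (`4 = 3¹²`, `13 = 3⁴`). [folklore] -/
theorem charSeventeen_elliptic (d : ℤ) (h : ((17 : ℕ) : ℤ) ∣ d * d + 1) : charSeventeen ((d : ZMod 17)) = 0 := by
  have h' : (((d * d + 1 : ℤ)) : ZMod 17) = 0 := (ZMod.intCast_zmod_eq_zero_iff_dvd _ 17).mpr h
  push_cast at h'
  revert h'
  generalize (d : ZMod 17) = x
  revert x
  decide

/-- **The order-`4` Shimura class at level `17`**: `φ : H₁(X₀(17), ℤ) →+ ℤ/4`, `φ({∞, k∞}) = log₃(d_k) mod 4`. [cite: Mazur1977, §II.11] -/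
theorem exists_shimuraHom_seventeen : ∃ φ : periodHomology 17 →+ ZMod 4, ∀ k : Gamma0 17,
    φ ⟨periodFunctional 17 k, periodFunctional_mem_periodHomology 17 k⟩ =
      charSeventeen ((((k : SL(2, ℤ)) 1 1 : ℤ) : ZMod 17)) :=
  exists_shimuraHom (dvd_refl 17) (cuspCondition_of_prime (by norm_num) (dvd_refl 17)) charSeventeen_mul
    charSeventeen_neg charSeventeen_elliptic (by decide)

/-- `γ₃ = (6 1; 17 3) ∈ Γ₀(17)`. [folklore] -/
def gammaThree : Gamma0 17 :=
  ⟨⟨!![6, 1; 17, 3], by rw [Matrix.det_fin_two_of]; norm_num⟩, by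
    rw [Gamma0_mem]
    show (((17 : ℤ) : ZMod 17)) = 0
    decide⟩

/-- `dim S₂(Γ₀(17)) = 1` (tree theorems `finrank_cuspForm_two_eq_genusX0_holds`, `genusX0_prime`). [folklore] -/
theorem finrank_cuspForm_two_seventeen : Module.finrank ℂ (CuspForm (Gamma0 17) 2) = 1 := by
  have h : genusX0 17 = 1 := by
    rw [genusX0_prime (by norm_num) (by norm_num)]; norm_num
  have := finrank_cuspForm_two_eq_genusX0_holds (N := 17)
  unfold finrank_cuspForm_two_eq_genusX0 at this
  rw [this, h]

/-- **`n·{∞, γ₃∞}_f ∉ Λ₁(f)` for `4 ∤ n`**, every non-zero `f ∈ S₂(Γ₀(17))`. [cite: Mazur1977, §II.11] -/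
theorem zsmul_cuspSymbol_gammaThree_not_mem_seventeen (f : CuspForm (Gamma0 17) 2) (hf : f ≠ 0) (n : ℤ)
    (hn : (n : ZMod 4) ≠ 0) : (n : ℂ) * cuspSymbol f gammaThree ∉ periodLatticeGamma1 f := by
  obtain ⟨φ, hφ⟩ := exists_shimuraHom_seventeen
  refine zsmul_cuspSymbol_not_mem_of_hom φ _ hφ (fun γ₁ ↦ char_apply_gamma1 (dvd_refl 17) charSeventeen (by decide) γ₁) f
    ((finrank_eq_one_iff_of_nonzero' f hf).mp finrank_cuspForm_two_seventeen) gammaThree n ?_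
  rw [show (((gammaThree : SL(2, ℤ)) 1 1 : ℤ)) = 3 from rfl, zsmul_eq_mul]
  rw [show charSeventeen ((3 : ℤ) : ZMod 17) = 1 from by decide, mul_one]
  exact hn

/-- **`{∞, γ₃∞}_f ∉ Λ₁(f)`**, so **`Λ(f) ≠ Λ₁(f)`**, at level `17` (`f ≠ 0`). [cite: Mazur1977, §II.11] -/
theorem periodLattice_ne_periodLatticeGamma1_seventeen (f : CuspForm (Gamma0 17) 2) (hf : f ≠ 0) :
    cuspSymbol f gammaThree ∉ periodLatticeGamma1 f ∧ periodLattice f ≠ periodLatticeGamma1 f := by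
  have h1 : cuspSymbol f gammaThree ∉ periodLatticeGamma1 f := by
    have := zsmul_cuspSymbol_gammaThree_not_mem_seventeen f hf 1 (by decide)
    rwa [Int.cast_one, one_mul] at this
  exact ⟨h1, fun h ↦ h1 (h ▸ cuspSymbol_mem_periodLattice f gammaThree)⟩

/-- **The `2`-part at `17`: `2·{∞, γ₃∞}_f ∉ Λ₁(f)`** — the class of `{∞, γ₃∞}_f` in `Λ(f)/Λ₁(f)` is not killed by `2`
(its order is divisible by `4`); in particular `2Λ(f) ⊄ Λ₁(f)`. [cite: Mazur1977, §II.11] -/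
theorem two_mul_cuspSymbol_gammaThree_not_mem_seventeen (f : CuspForm (Gamma0 17) 2) (hf : f ≠ 0) :
    (2 : ℂ) * cuspSymbol f gammaThree ∉ periodLatticeGamma1 f ∧
      ¬ ∀ z ∈ periodLattice f, (2 : ℂ) * z ∈ periodLatticeGamma1 f := by
  have h2 : (2 : ℂ) * cuspSymbol f gammaThree ∉ periodLatticeGamma1 f := by
    have := zsmul_cuspSymbol_gammaThree_not_mem_seventeen f hf 2 (by decide)
    rwa [Int.cast_ofNat] at this
  exact ⟨h2, fun h ↦ h2 (h _ (cuspSymbol_mem_periodLattice f gammaThree))⟩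

end Seventeen

/-! ## §4. The additive level `20 = 4·5`: the Shimura index is even -/

section Twenty

/-- `χ₅` = the Legendre symbol mod `5` read additively in `ℤ/2` (`2, 3 ↦ 1`; `0, 1, 4 ↦ 0`). [folklore] -/
def charFive (x : ZMod 5) : ZMod 2 :=
  match x.val with
  | 2 => 1 | 3 => 1
  | _ => 0

/-- `χ₅` is additive on units. [folklore] -/
theorem charFive_mul : ∀ x x' y y' : ZMod 5, x * x' = 1 → y * y' = 1 → charFive (x * y) = charFive x + charFive y := by
  decide

/-- `χ₅` is even (`5 ≡ 1 mod 4`). [folklore] -/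
theorem charFive_neg : ∀ x : ZMod 5, charFive (-x) = charFive x := by decide

/-- **The `2`-primary Shimura class at the ADDITIVE level `20`**: `φ : H₁(X₀(20), ℤ) →+ ℤ/2`, `φ({∞, k∞}) = [(d_k | 5) = −1]`.
[cite: LingOesterle1991, Thm. 1] -/
theorem exists_shimuraHom_twenty : ∃ φ : periodHomology 20 →+ ZMod 2, ∀ k : Gamma0 20,
    φ ⟨periodFunctional 20 k, periodFunctional_mem_periodHomology 20 k⟩ = charFive ((((k : SL(2, ℤ)) 1 1 : ℤ) : ZMod 5)) :=
  exists_shimuraHom_of_four_dvd (by norm_num) (by norm_num) (by norm_num) charFive charFive_mul charFive_neg (by decide)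

/-- `γ₇ = (3 1; 20 7) ∈ Γ₀(20)`, `(7 | 5) = −1`. [folklore] -/
def gammaSeven : Gamma0 20 :=
  ⟨⟨!![3, 1; 20, 7], by rw [Matrix.det_fin_two_of]; norm_num⟩, by
    rw [Gamma0_mem]
    show (((20 : ℤ) : ZMod 20)) = 0
    decide⟩

/-- **`{∞, γ₇∞}_f ∉ Λ₁(f)` for every non-zero `f ∈ S₂(Γ₀(20))`.** [cite: LingOesterle1991, Thm. 1] -/
theorem cuspSymbol_gammaSeven_not_mem_twenty (f : CuspForm (Gamma0 20) 2) (hf : f ≠ 0) :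
    cuspSymbol f gammaSeven ∉ periodLatticeGamma1 f := by
  obtain ⟨φ, hφ⟩ := exists_shimuraHom_twenty
  have := zsmul_cuspSymbol_not_mem_of_hom φ _ hφ (fun γ₁ ↦ char_apply_gamma1 (by norm_num) charFive (by decide) γ₁) f
    ((finrank_eq_one_iff_of_nonzero' f hf).mp finrank_cuspForm_two_eq_genusX0_twenty.2.1) gammaSeven 1 (by
      rw [show (((gammaSeven : SL(2, ℤ)) 1 1 : ℤ)) = 7 from rfl, one_zsmul]
      decide)
  rwa [Int.cast_one, one_mul] at this

/-- **THE SHIMURA INDEX AT THE ADDITIVE LEVEL `20` IS EVEN: `Λ(f) ≠ Λ₁(f)` with a class of order `2`** (`2·{∞, γ₇∞}_f ∈ Λ₁(f)`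
by the tree's Eisenstein-type law is not needed here; we record non-membership and `Λ ≠ Λ₁`). [cite: LingOesterle1991, Thm. 1] -/
theorem periodLattice_ne_periodLatticeGamma1_twenty (f : CuspForm (Gamma0 20) 2) (hf : f ≠ 0) :
    periodLattice f ≠ periodLatticeGamma1 f := fun h ↦
  cuspSymbol_gammaSeven_not_mem_twenty f hf (h ▸ cuspSymbol_mem_periodLattice f gammaSeven)

end Twenty

/-! ## §5. The additive genus-one levels `24 = 8·3` and `32 = 2⁵`: the Shimura index is even -/

section TwentyFourThirtyTwo

/-- `χ₁₂` = the even quadratic character mod `12` (`(12 | ·)`: units `5, 7 ↦ 1`; `1, 11 ↦ 0`) read in `ℤ/2`. [folklore] -/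
def charTwelve (x : ZMod 12) : ZMod 2 :=
  match x.val with
  | 5 => 1 | 7 => 1
  | _ => 0

/-- `χ₁₂` is additive on units. [folklore] -/
theorem charTwelve_mul : ∀ x x' y y' : ZMod 12, x * x' = 1 → y * y' = 1 →
    charTwelve (x * y) = charTwelve x + charTwelve y := by
  decide

/-- `χ₁₂` is even. [folklore] -/
theorem charTwelve_neg : ∀ x : ZMod 12, charTwelve (-x) = charTwelve x := by decide

/-- The cusp condition `24 ∣ w r² ⇒ 12 ∣ w r` (residues mod `24`). [folklore] -/
theorem cuspCondition_twentyFour_twelve : ∀ a b : ZMod 24, a * b ^ 2 = 0 → (a * b).val % 12 = 0 := by decide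

/-- **The `2`-primary Shimura class at the additive level `24`**: `φ({∞, k∞}) = [(12 | d_k) = −1]`. [cite: LingOesterle1991, Thm. 1] -/
theorem exists_shimuraHom_twentyFour : ∃ φ : periodHomology 24 →+ ZMod 2, ∀ k : Gamma0 24,
    φ ⟨periodFunctional 24 k, periodFunctional_mem_periodHomology 24 k⟩ = charTwelve ((((k : SL(2, ℤ)) 1 1 : ℤ) : ZMod 12)) :=
  exists_shimuraHom (by norm_num) (cuspCondition_of_residues (by norm_num) cuspCondition_twentyFour_twelve) charTwelve_mul
    charTwelve_neg (elliptic_vacuous_of_four_dvd (by norm_num)) (by decide)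

/-- `γ₅ = (5 1; 24 5) ∈ Γ₀(24)`, `(12 | 5) = −1`. [folklore] -/
def gammaFiveLevel24 : Gamma0 24 :=
  ⟨⟨!![5, 1; 24, 5], by rw [Matrix.det_fin_two_of]; norm_num⟩, by
    rw [Gamma0_mem]
    show (((24 : ℤ) : ZMod 24)) = 0
    decide⟩

/-- `dim S₂(Γ₀(24)) = 1` (tree theorems `finrank_cuspForm_two_eq_genusX0_holds`, `genusX0_twentyFour`). [folklore] -/
theorem finrank_cuspForm_two_twentyFour : Module.finrank ℂ (CuspForm (Gamma0 24) 2) = 1 := by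
  have := finrank_cuspForm_two_eq_genusX0_holds (N := 24)
  unfold finrank_cuspForm_two_eq_genusX0 at this
  rw [this, genusX0_twentyFour]

/-- **THE SHIMURA INDEX AT THE ADDITIVE LEVEL `24` IS EVEN**: `{∞, γ₅∞}_f ∉ Λ₁(f)` and `Λ(f) ≠ Λ₁(f)` for every non-zero
`f ∈ S₂(Γ₀(24))` (E15 row `24a1`: index `2`). [cite: LingOesterle1991, Thm. 1] -/
theorem periodLattice_ne_periodLatticeGamma1_twentyFour (f : CuspForm (Gamma0 24) 2) (hf : f ≠ 0) :
    cuspSymbol f gammaFiveLevel24 ∉ periodLatticeGamma1 f ∧ periodLattice f ≠ periodLatticeGamma1 f := by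
  obtain ⟨φ, hφ⟩ := exists_shimuraHom_twentyFour
  have h1 : cuspSymbol f gammaFiveLevel24 ∉ periodLatticeGamma1 f := by
    have := zsmul_cuspSymbol_not_mem_of_hom φ _ hφ (fun γ₁ ↦ char_apply_gamma1 (by norm_num) charTwelve (by decide) γ₁) f
      ((finrank_eq_one_iff_of_nonzero' f hf).mp finrank_cuspForm_two_twentyFour) gammaFiveLevel24 1 (by
        rw [show (((gammaFiveLevel24 : SL(2, ℤ)) 1 1 : ℤ)) = 5 from rfl, one_zsmul]
        decide)
    rwa [Int.cast_one, one_mul] at this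
  exact ⟨h1, fun h ↦ h1 (h ▸ cuspSymbol_mem_periodLattice f gammaFiveLevel24)⟩

/-- `χ₈ = (2 | ·)` read in `ℤ/2` (units `3, 5 ↦ 1`; `1, 7 ↦ 0`). [folklore] -/
def charEight (x : ZMod 8) : ZMod 2 :=
  match x.val with
  | 3 => 1 | 5 => 1
  | _ => 0

/-- `χ₈` is additive on units. [folklore] -/
theorem charEight_mul : ∀ x x' y y' : ZMod 8, x * x' = 1 → y * y' = 1 →
    charEight (x * y) = charEight x + charEight y := by
  decide

/-- `χ₈` is even. [folklore] -/
theorem charEight_neg : ∀ x : ZMod 8, charEight (-x) = charEight x := by decide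

/-- The cusp condition `32 ∣ w r² ⇒ 8 ∣ w r` (residues mod `32`; `8 = 2³`, `2⁵ ∣ 32`). [folklore] -/
theorem cuspCondition_thirtyTwo_eight : ∀ a b : ZMod 32, a * b ^ 2 = 0 → (a * b).val % 8 = 0 := by decide

/-- **The `2`-primary Shimura class at the additive level `32`**: `φ({∞, k∞}) = [(2 | d_k) = −1]`. [cite: LingOesterle1991, Thm. 1] -/
theorem exists_shimuraHom_thirtyTwo : ∃ φ : periodHomology 32 →+ ZMod 2, ∀ k : Gamma0 32,
    φ ⟨periodFunctional 32 k, periodFunctional_mem_periodHomology 32 k⟩ = charEight ((((k : SL(2, ℤ)) 1 1 : ℤ) : ZMod 8)) :=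
  exists_shimuraHom (by norm_num) (cuspCondition_of_residues (by norm_num) cuspCondition_thirtyTwo_eight) charEight_mul
    charEight_neg (elliptic_vacuous_of_four_dvd (by norm_num)) (by decide)

/-- `γ = (13 2; 32 5) ∈ Γ₀(32)`, `(2 | 5) = −1`. [folklore] -/
def gammaFiveLevel32 : Gamma0 32 :=
  ⟨⟨!![13, 2; 32, 5], by rw [Matrix.det_fin_two_of]; norm_num⟩, by
    rw [Gamma0_mem]
    show (((32 : ℤ) : ZMod 32)) = 0
    decide⟩

/-- **THE SHIMURA INDEX AT THE ADDITIVE LEVEL `32` IS EVEN**: `{∞, γ∞}_f ∉ Λ₁(f)` (`γ = (13 2; 32 5)`) and `Λ(f) ≠ Λ₁(f)` for every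
non-zero `f ∈ S₂(Γ₀(32))` (E15 row `32a1`: index `2`). [cite: LingOesterle1991, Thm. 1] -/
theorem periodLattice_ne_periodLatticeGamma1_thirtyTwo (f : CuspForm (Gamma0 32) 2) (hf : f ≠ 0) :
    cuspSymbol f gammaFiveLevel32 ∉ periodLatticeGamma1 f ∧ periodLattice f ≠ periodLatticeGamma1 f := by
  obtain ⟨φ, hφ⟩ := exists_shimuraHom_thirtyTwo
  have h1 : cuspSymbol f gammaFiveLevel32 ∉ periodLatticeGamma1 f := by
    have := zsmul_cuspSymbol_not_mem_of_hom φ _ hφ (fun γ₁ ↦ char_apply_gamma1 (by norm_num) charEight (by decide) γ₁) f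
      ((finrank_eq_one_iff_of_nonzero' f hf).mp finrank_cuspForm_two_eq_genusX0_thirtyTwo.2.1) gammaFiveLevel32 1 (by
        rw [show (((gammaFiveLevel32 : SL(2, ℤ)) 1 1 : ℤ)) = 5 from rfl, one_zsmul]
        decide)
    rwa [Int.cast_one, one_mul] at this
  exact ⟨h1, fun h ↦ h1 (h ▸ cuspSymbol_mem_periodLattice f gammaFiveLevel32)⟩

end TwentyFourThirtyTwo

end Summit.BirchSwinnertonDyer.BirchSwinnertonDyer.Theorems.ManinLocalTwoThree.ShimuraClass
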